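import Summits.QuantumFields.BalabanUV.Beta.FP.TowerFWeightCoclosedPairing

/-!
# `BalabanUV.Beta.FP.TowerFWeightGaugeDropout` — row D1 ∕ (C1) OWNER «beta-an2», PART 99, ROUTE T (β1), option (3a), FINDING AN2-85-1 (B), second half: **THE RECORD GAUGE
# FUNCTION DROPS OUT ON CO-CLOSED COVECTORS** — `contourSum N (respCol …) = contourSum N (colH (chartσ …)) − dz (blockSum N (lamRecG …))` (lit `AffineAveraging.contourSum_dz`),
# the coarse gradient is invisible to a bounded co-closed covector (an2 g60 `CoclosedCovectorLinearRows.lip1_dz_eq_zero_of_bounded`; summability of `blockSum N lamRecG` from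
# PART 83 `exists_abs_lamZG_record_le_exp`), hence with PART 98 `lip1_wFRec_rooted ∕ _sym`:
# **`⟨ψ, wFRec … n μ y⟩ = ((Lc⁴)⁻¹)^(n+1) · ⟨ψ, contourSum (Lc^(n+1)) (colH (chartσ Lc (sn n) n) (Lc^(n+2)) μ y)⟩`** for every bounded co-closed middle covector `ψ`, at both row
# tokens — the composite rows AND the gauge function are gone BY NAME; what remains to compare with `wStep Lc (n+1)` is the K1-type column letter (K1ᶜ) (displayed; by value K1.md ∕
# A2-HQF0) (journal [AN2-G85-W-11]) (β-function cell `pub-balaban`, BINDER-OWNERS row D1)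

WHAT ([folklore]; 0 `def`): `summable_comp_affine_of_exp` (exp-decaying functions along affine sublattices are summable), `contourSum_respCol`, `summable_contourSum_colH`,
`summable_blockSum_lamRecG`, **`lip1_contourSum_respCol`**, **`lip1_wFRec_rooted_eq_colH ∕ lip1_wFRec_sym_eq_colH`**.
WHAT THIS IS NOT: not (K1ᶜ); not the dual Ward bridge (road side); nothing of the END instantiated; nothing of Bałaban's asserted, valued or discharged; 0 estimates beyond
[folklore] summability bookkeeping; 0∕4 row-D1 binders; NOT (C1), NOT D1, NEVER «G-an2-4 closed», NOT BetaPertH, NOT continuum, NOT Clay.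

HONEST DEPENDENCY (page 1, mandatory): continuum YM on T⁴ ⇐ BetaPertH ∧ nine spine estimates (0/9 proved); BetaPertH ⇐ (D1) ∧ (D4) ∧ CAP+tail;
G-an2-4 gates asym, D1 and NE2/3/4.  HONEST FRAMING (cell contract, verbatim): «discharging `BetaPertH` makes Bałaban's UV stability UNCONDITIONAL —
a real constructive-QFT result; it is NOT the continuum limit and NOT the Clay problem.»  ABSOLUTE RULE (cell charter, verbatim): «No internally-minted
statement may enter as a cited fact. Every hypothesis is either kernel-proved in this package or a verbatim quotation of a PUBLISHED theorem with page
reference. The manuscript(s) under audit are NOT citable for their own disputed steps — they are the thing under adjudication; programme-internal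
(2001/route/tribunal) claims are never citable.»  Row D1 ∕ (C1) OWNER «beta-an2», b2b-balaban-beta-an2 gen 85, 2026-08-30.  No existing file touched.
-/

noncomputable section

open Finset
open scoped BigOperators
open Literature.MathematicalPhysics.QuantumFieldTheory
open Literature.MathematicalPhysics.QuantumFieldTheory.Balaban1983to89
open Literature.MathematicalPhysics.QuantumFieldTheory.Balaban1983to89.Beta
open B12Sec2to5 (l1 l1_nonneg)
open ExpKernelCalculus (l1_sub_triangle l1_sub_symm)
open AffineAveraging (Form0 Form1 Site box toSite unitVec dz codiff₁ contourSum blockSum contourSum_dz)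
open AveragingContoursRooted (ctrOff ctrOff_mem_box)
open AveragingHessianKernels (Bond)
open AveragingHessianKernelsRooted (linKerAt)
open OneStepKernelFamily (colH)
open KKTFluctuationEnergy (lip1)
open Summit.QuantumFields.BalabanUV.Beta.SymAveragingHessianCounts (symLinKerAt)
open Summit.QuantumFields.BalabanUV.Beta.CompositeOneShotJetData (Roots Roots.ctr AN)
open Summit.QuantumFields.BalabanUV.Beta.GAN24.FineReadoutCauchyFrame (toSite_mem_range)
open Summit.QuantumFields.BalabanUV.Beta.FP.TorusCompositeObjects (bigRatio)
open Summit.QuantumFields.BalabanUV.Beta.FP.TorusCompositeObjectsG (StepRows)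
open Summit.QuantumFields.BalabanUV.Beta.FP.TowerDoorRecordDefsG (lamRecG)
open Summit.QuantumFields.BalabanUV.Beta.FP.TowerFWeightRecDefs
open Summit.QuantumFields.BalabanUV.Beta.CoclosedCovectorLinearRows (lip1_dz_eq_zero_of_bounded)
open Summit.QuantumFields.BalabanUV.Beta.FP.TowerFWeightCoclosedPairing (lip1_wFRec_rooted lip1_wFRec_sym)

namespace Summit.QuantumFields.BalabanUV.Beta.FP.TowerFWeightGaugeDropout

/-! ## §1 The record gauge function drops out on co-closed covectors -/

section Gauge

/-- [folklore] a function decaying exponentially from a centre, read along an affine sublattice `x ↦ N•x + v` (`N ≥ 1`), is summable. -/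
theorem summable_comp_affine_of_exp {g : Site (3 + 1) → ℝ} {C δ : ℝ} (hC : 0 ≤ C) (hδ : 0 < δ) (c₀ : Site (3 + 1))
    (hg : ∀ u, |g u| ≤ C * Real.exp (-δ * l1 (u - c₀))) {N : ℕ} (hN : 1 ≤ N) (v : Site (3 + 1)) :
    Summable fun x : Site (3 + 1) => g ((N : ℤ) • x + v) := by
  have hmaj : ∀ x : Site (3 + 1), |g ((N : ℤ) • x + v)| ≤ (C * Real.exp (δ * l1 (c₀ - v - 0))) * Real.exp (-δ * l1 (x - 0)) := by
    intro x
    refine (hg _).trans ?_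
    rw [mul_assoc, ← Real.exp_add]
    refine mul_le_mul_of_nonneg_left (Real.exp_le_exp.2 ?_) hC
    have htri : l1 ((N : ℤ) • x - 0) ≤ l1 ((N : ℤ) • x - (c₀ - v)) + l1 ((c₀ - v) - 0) := l1_sub_triangle _ _ _
    have heq : (N : ℤ) • x - (c₀ - v) = (N : ℤ) • x + v - c₀ := by abel
    rw [heq] at htri
    have hsc : l1 (x - 0) ≤ l1 ((N : ℤ) • x - 0) := by
      rw [sub_zero, sub_zero, TowerFWeightRecLoc.l1_natCast_smul']
      have h1 : (1 : ℝ) ≤ (N : ℝ) := by exact_mod_cast hN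
      have h0 : 0 ≤ l1 x := l1_nonneg _
      nlinarith
    nlinarith [l1_nonneg ((c₀ - v) - 0)]
  refine (((ExpKernelCalculus.summable_exp_shift' hδ (0 : Site (3 + 1))).mul_left (C * Real.exp (δ * l1 (c₀ - v - 0)))).of_norm_bounded ?_)
  intro x
  rw [Real.norm_eq_abs]
  exact hmaj x

variable (Lc : ℕ) [NeZero Lc] (Q : StepRows 3 Lc) (sn : ℕ → ℝ)

/-- [folklore] **`contourSum_respCol`**: `contourSum N (respCol …) = contourSum N (colH (chartσ …) (Lc^(n+2)) μ y) − dz (blockSum N (lamRecG … μ y))` (lit `contourSum_dz`). -/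
theorem contourSum_respCol (N : ℕ) (s : ℝ) (n : ℕ) (μ : Fin (3 + 1)) (y : Site (3 + 1)) :
    contourSum N (respCol Lc Q s n μ y)
      = fun κ t => contourSum N (fun κ' u => colH (chartσ Lc s n) (Lc ^ (n + 1 + 1)) μ y κ' u) κ t - dz (blockSum N (lamRecG Lc Q s n μ y)) κ t := by
  funext κ t
  rw [← contourSum_dz]
  simp only [contourSum, respCol_eq, Finset.sum_sub_distrib]

/-- [folklore] the straight contour sum of the σ-chart's `ℋ`-column is summable along the middle sites (column decay: an2 `decays_scaleK_AN` + lit `abs_colH_le`). -/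
theorem summable_contourSum_colH (N : ℕ) (hN : 1 ≤ N) (s : ℝ) (n : ℕ) (μ : Fin (3 + 1)) (y : Site (3 + 1)) (κ : Fin (3 + 1)) :
    Summable fun t : Site (3 + 1) => contourSum N (fun κ' u => colH (chartσ Lc s n) (Lc ^ (n + 1 + 1)) μ y κ' u) κ t := by
  obtain ⟨δ, C, hδ, hC, hA⟩ := TowerDoorGaugeBound.decays_scaleK_AN (Roots.ctr Lc)
    (Sum.elim (fun _ : Fin (3 + 1) => (1 : ℝ)) (fun _ : Fin (3 + 1) => s⁻¹)) (n + 1)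
  have hcol : ∀ u, |colH (chartσ Lc s n) (Lc ^ (n + 1 + 1)) μ y κ u| ≤ C * Real.exp (-δ * l1 (u - (((Lc ^ (n + 1 + 1) : ℕ) : ℤ)) • y)) :=
    fun u => OneStepKernelFamily.abs_colH_le (N := Lc ^ (n + 1 + 1)) hA μ y κ u
  simp only [contourSum]
  refine summable_sum fun b _ => summable_sum fun r _ => ?_
  have h := summable_comp_affine_of_exp hC hδ _ hcol hN (toSite b + (r : ℤ) • unitVec κ)
  refine h.congr fun t => ?_
  simp only [add_assoc]

/-- [folklore] the block sum of the record gauge function is summable along the middle sites (PART 83 `exists_abs_lamZG_record_le_exp`). -/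
theorem summable_blockSum_lamRecG (N : ℕ) (hN : 1 ≤ N) (s : ℝ) (n : ℕ) (μ : Fin (3 + 1)) (y : Site (3 + 1)) :
    Summable (blockSum N (lamRecG Lc Q s n μ y)) := by
  obtain ⟨δ, hδ, K, hK, hlamb⟩ := TowerDoorGaugeBoundG.exists_abs_lamZG_record_le_exp Q (Roots.ctr Lc) (fun i : ℕ => n + 1 - i)
    (fun _ : ℕ => ctrOff (3 + 1) Lc) (fun _ => toSite_mem_range (ctrOff_mem_box (d := 3 + 1) (Nat.one_le_iff_ne_zero.mpr (NeZero.ne Lc)))) n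
    (Sum.elim (fun _ : Fin (3 + 1) => (1 : ℝ)) (fun _ : Fin (3 + 1) => s⁻¹))
  have hlam : ∀ u : Site (3 + 1), |lamRecG Lc Q s n μ y u| ≤ K * Real.exp (-δ * l1 (u - ((bigRatio Lc (n + 1) : ℕ) : ℤ) • y)) := by
    intro u
    have h := hlamb μ y u
    rw [l1_sub_symm] at h
    exact h
  show Summable fun t : Site (3 + 1) => ∑ b ∈ box (3 + 1) N, lamRecG Lc Q s n μ y ((N : ℤ) • t + toSite b)
  exact summable_sum fun b _ => summable_comp_affine_of_exp hK hδ _ hlam hN (toSite b)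

/-- [folklore] **`lip1_contourSum_respCol` — THE RECORD GAUGE FUNCTION DROPS OUT**: for a bounded co-closed middle covector `ψ`,
`⟨ψ, contourSum N (respCol …)⟩ = ⟨ψ, contourSum N (colH (chartσ …) (Lc^(n+2)) μ y)⟩` (its other summand is the coarse gradient `dz (blockSum N lamRecG)`, invisible to `ψ`:
an2 g60 `lip1_dz_eq_zero_of_bounded`). -/
theorem lip1_contourSum_respCol {N : ℕ} (hN : 1 ≤ N) {ψ : Form1 (3 + 1) ℝ} {M : ℝ} (hψ : ∀ c t, |ψ c t| ≤ M) (hco : codiff₁ ψ = 0)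
    (s : ℝ) (n : ℕ) (μ : Fin (3 + 1)) (y : Site (3 + 1)) :
    lip1 ψ (contourSum N (respCol Lc Q s n μ y))
      = lip1 ψ (contourSum N (fun κ' u => colH (chartσ Lc s n) (Lc ^ (n + 1 + 1)) μ y κ' u)) := by
  have hM : 0 ≤ M := (abs_nonneg _).trans (hψ 0 0)
  have hz : lip1 ψ (dz (blockSum N (lamRecG Lc Q s n μ y))) = 0 :=
    lip1_dz_eq_zero_of_bounded hψ hco (summable_blockSum_lamRecG Lc Q N hN s n μ y)
  -- summability of the two pairings
  have hsA : Summable fun t : Site (3 + 1) => ∑ c : Fin (3 + 1),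
      ψ c t * contourSum N (fun κ' u => colH (chartσ Lc s n) (Lc ^ (n + 1 + 1)) μ y κ' u) c t := by
    refine summable_sum fun c _ => ?_
    have h := summable_contourSum_colH Lc N hN s n μ y c
    refine (h.abs.mul_left M).of_norm_bounded fun t => ?_
    rw [Real.norm_eq_abs, abs_mul]
    exact mul_le_mul_of_nonneg_right (hψ c t) (abs_nonneg _)
  have hsB : Summable fun t : Site (3 + 1) => ∑ c : Fin (3 + 1), ψ c t * dz (blockSum N (lamRecG Lc Q s n μ y)) c t := by
    refine summable_sum fun c _ => ?_
    have hb := summable_blockSum_lamRecG Lc Q N hN s n μ y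
    have h1 : Summable fun t : Site (3 + 1) => blockSum N (lamRecG Lc Q s n μ y) (t + unitVec c) :=
      ((Equiv.addRight (unitVec c)).summable_iff.2 hb).congr fun t => rfl
    have hd : Summable fun t : Site (3 + 1) => dz (blockSum N (lamRecG Lc Q s n μ y)) c t := by
      simp only [dz]
      exact h1.sub hb
    refine (hd.abs.mul_left M).of_norm_bounded fun t => ?_
    rw [Real.norm_eq_abs, abs_mul]
    exact mul_le_mul_of_nonneg_right (hψ c t) (abs_nonneg _)
  rw [contourSum_respCol]
  unfold lip1 at hz ⊢
  have hsplit : ∀ t, ∑ c : Fin (3 + 1), ψ c t * (contourSum N (fun κ' u => colH (chartσ Lc s n) (Lc ^ (n + 1 + 1)) μ y κ' u) c t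
        - dz (blockSum N (lamRecG Lc Q s n μ y)) c t)
      = (∑ c : Fin (3 + 1), ψ c t * contourSum N (fun κ' u => colH (chartσ Lc s n) (Lc ^ (n + 1 + 1)) μ y κ' u) c t)
        - ∑ c : Fin (3 + 1), ψ c t * dz (blockSum N (lamRecG Lc Q s n μ y)) c t := by
    intro t
    rw [← Finset.sum_sub_distrib]
    exact Finset.sum_congr rfl fun c _ => by ring
  simp_rw [hsplit]
  rw [hsA.tsum_sub hsB, hz, sub_zero]

variable (R : Roots Lc)

/-- [folklore] **`lip1_wFRec_rooted_eq_colH` — THE DUAL GAUGE STATEMENT, ROW SIDE, ROOTED ROWS**: for every bounded co-closed middle covector `ψ`,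
`⟨ψ, wFRec … n μ y⟩ = ((Lc⁴)⁻¹)^(n+1) · ⟨ψ, contourSum (Lc^(n+1)) (colH (chartσ …) (Lc^(n+2)) μ y)⟩` — the composite rows AND the record gauge function have dropped out BY NAME;
what is left is the straight `Lc^(n+1)`-contour sum of the σ-chart's `ℋ`-column (to be compared with `wStep Lc (n+1)` by the K1-type column letter (K1ᶜ), displayed). -/
theorem lip1_wFRec_rooted_eq_colH {ψ : Form1 (3 + 1) ℝ} {M : ℝ} (hψ : ∀ c t, |ψ c t| ≤ M) (hco : codiff₁ ψ = 0) (n : ℕ)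
    (μ : Fin (3 + 1)) (y : Site (3 + 1)) :
    lip1 ψ (fun c t => wFRec Lc Q (linKerAt (toSite (ctrOff (3 + 1) Lc)) Lc) sn n μ y c t)
      = ((((Lc : ℝ) ^ (3 + 1))⁻¹) ^ (n + 1)) * lip1 ψ (contourSum (Lc ^ (n + 1)) (fun κ' u => colH (chartσ Lc (sn n) n) (Lc ^ (n + 1 + 1)) μ y κ' u)) := by
  rw [lip1_wFRec_rooted Lc Q sn hψ hco n μ y,
    lip1_contourSum_respCol Lc Q (Nat.one_le_pow _ _ (Nat.pos_of_ne_zero (NeZero.ne Lc))) hψ hco (sn n) n μ y]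

/-- [folklore] **`lip1_wFRec_sym_eq_colH`** — the same at the SYM rows of a root record `R`. -/
theorem lip1_wFRec_sym_eq_colH {ψ : Form1 (3 + 1) ℝ} {M : ℝ} (hψ : ∀ c t, |ψ c t| ≤ M) (hco : codiff₁ ψ = 0) (n : ℕ)
    (μ : Fin (3 + 1)) (y : Site (3 + 1)) :
    lip1 ψ (fun c t => wFRec Lc Q (symLinKerAt (toSite R.r) Lc) sn n μ y c t)
      = ((((Lc : ℝ) ^ (3 + 1))⁻¹) ^ (n + 1)) * lip1 ψ (contourSum (Lc ^ (n + 1)) (fun κ' u => colH (chartσ Lc (sn n) n) (Lc ^ (n + 1 + 1)) μ y κ' u)) := by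
  rw [lip1_wFRec_sym Lc Q sn R hψ hco n μ y,
    lip1_contourSum_respCol Lc Q (Nat.one_le_pow _ _ (Nat.pos_of_ne_zero (NeZero.ne Lc))) hψ hco (sn n) n μ y]

end Gauge

end Summit.QuantumFields.BalabanUV.Beta.FP.TowerFWeightGaugeDropout

end
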